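/-
Copyright (c) 2026 the pub-hodgecm-mathlib formalisation cell (harness21).  Prover seat hodgecm-mathlib-F0P3a-p01 (g33), req620 Track A «(D-RAM) FOUR-FRAME» squad, unit U2H:
the (ρ2b′-X) child (U2H ED. 15 :418) — organ O-Lit brick 2 (wild anisotropic literal), file (β) «THE TWIST SCALAR `n₀` WITH NON-NORM NORM» (PLAN v1 04:56Z; MAP v1 seams S3∕S5;
payer lineage LH4-p14, O-W LH4-p12 (g4) PAYER-PLAN v2 D2 «`(a₀, θ_E)_F = −1`»).  2026-09-04.
-/
import Literature.NumberTheory.Rogawski1990.RamifiedPlaceNormSymbolDichotomy      -- ★ `hilbertSymbol_eq_neg_one_iff_not_exists_norm_toPlace` (norm reading of `(·, θ)_v`)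
import Literature.NumberTheory.LocalFields.QuadraticLocalNormDichotomy              -- ★ (J3′) `IsCMField.exists_fixed_nonnorm_dichotomy'` (a σ_w-fixed non-norm exists, any place)
import Literature.NumberTheory.QuadraticForms.LocalNormIndex                         -- ★ `adicCompletion_exists_hilbertSymbol_eq_neg_one_holds` (O'Meara 63:13 non-degeneracy, any place)
import Literature.NumberTheory.QuadraticForms.HilbertSymbolBilinear                  -- ★ `hilbertSymbol_adicCompletion_mul_left∕right` (bimultiplicativity, any place)
import Literature.NumberTheory.QuadraticForms.HasseMinkowskiTernaryLemmas            -- ★ `hilbertSymbol_eq_one_iff_exists_norm` (`(a, b) = 1 ⟺ b = x² − a y²`)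
import Literature.NumberTheory.Automorphic.UnitaryGroupInertPlaceHyperbolicBasis     -- ★ `exists_toPlace_eq_of_galAdicCompletionMap_eq`, `galAdicCompletionMap_galAdicCompletionMap_of_smul_eq`
import Literature.NumberTheory.NumberFields.QuadraticCompletionAtNonsplitPlace        -- ★ «LQC» `algebraMap_adicCompletion_sq_eq_toPlace`
import HarnessLib

/-!
# Crux `H413`, line LH4 «(D-RAM) FOUR-FRAME» road — unit U2H, (ρ2b′-X), organ O-Lit brick 2, file (β): THE TWIST SCALAR `n₀ ∈ K♮` WHOSE NORM IS NOT A NORM FROM `L_w`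

Cell `hodgecm-mathlib` (D-0151), FLOOR 0, crux item H413 = `stmt-HodgeConjecture-24833`, route of record `HCCMUnconditional`; squad F0∕P3c∕LH4; registered stub served:
`F0P3cDyRamFourFrameU2H.stub_U2H_fixedPointCensus_typeTwo_unit0` ((ρ2b′-X), U2H ED. 15 :418) through the organs of RHO2BX-ORDER v1 (payer LH4-p14; MAP v1 seams S3 «O-Lit» and S5
«N(ta)»).  THEOREMS ONLY (no `def`, no instance, no notation, no `sorry`); lane `--supports stmt-HodgeConjecture-24833 --as helper` (count-neutral).

WHAT THIS FILE DOES (LH4-p12 (g3) PAYER-PLAN v2 §1 D2: «`h′ = h·n₀`, `n₀ ∉ N_{M∕K♮}M^×`; the line value `a₀` has `(a₀, θ_E)_F = −1`»).  With file (α) `F0P3cDyRamPartnerPlane.exists_partnerPlane` the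
determinant class of the partner plane is `N_{M∕E}(n₀) = n₀·ρ(n₀)`; the anisotropic partner needs this to be a NON-NORM from `E = L_w`.  Frame: the eigen-field package of ★ T3-E
(`F0P3cDyRamEigenFieldPackageTypeTwo.exists_eigenPackage`, p857432): `jE : E →+* M`, `ρ Θ : M →+* M`, `ρ ∘ jE = jE`, `Θ ∘ jE = jE ∘ σ`, `ρρ = id`, `Θρ = ρΘ`, `Fix ρ = jE(E)`, and the
eigenvalue `λ` (`λ² = tλ − D`, `ρλ = t − λ`, `Θ(λ)·λ = 1`) of a `σ`-unitary block (`D·σD = 1`, `t² ≠ 4D`).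
* §1 `exists_fixed_antifixed` (pure algebra): there are `κ ∈ M` and `β₀ ∈ E` with `Θ κ = κ`, `ρ κ = −κ`, `κ ≠ 0`, `σ β₀ = β₀`, `κ² = jE β₀`, `β₀` NOT a square in `E` — `κ = jE(ξ)·(λ − ρλ)`
  for a solution `ξ ≠ 0` of `σ(ξ)·(−σD) = ξ` (`ξ = 1 − σD`, or `2ϑ` with `σϑ = −ϑ` when `D = 1`); so `K♮ := jE(F) + jE(F)·κ` is the Θ-fixed quadratic `F`-algebra and
  `N_{M∕E}(x + yκ) = x² − β₀y²` (`twist_norm`, `twist_fixed`).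
* §2 **`exists_twistScalar`** (CM frame: `E = L_w`, `σ = σ_w`, `w ∣ v` fixed by complex conjugation, ANY residue characteristic): there are `n₀ ∈ M` and `a₀ ∈ L⁺_v` with `Θ n₀ = n₀`,
  `n₀ ≠ 0`, `a₀ ≠ 0`, `n₀·ρ(n₀) = jE(ι_w a₀)` and **`(a₀, θ)_v = −1`** (`θ` the CM generator: `ι_w a₀` is NOT a norm from `L_w`, ★ `hilbertSymbol_eq_neg_one_iff_not_exists_norm_toPlace`).
  Proof: `β₀ = ι_w β`, and `θβ` is a non-square of `L⁺_v` (else `β₀` is a square); O'Meara 63:13 (★ `adicCompletion_exists_hilbertSymbol_eq_neg_one_holds`) gives `α` with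
  `(α, θβ)_v = −1 = (α, θ)_v·(α, β)_v` (★ bimultiplicativity); with a non-norm `ε` (★ (J3′)) one of `α, ε, εα` has `(·, θ)_v = −1`, `(·, β)_v = 1`; the latter means `a₀ = x² − βy²`
  (★ `hilbertSymbol_eq_one_iff_exists_norm`), and `n₀ := jE(ι_w x) + jE(ι_w y)·κ`.  No `|2| = 1`, no parity of `d`: dyadic-safe.
HONEST LABEL.  Count-neutral helper; (ρ2b′-X) stays an OPEN prover target; `HC_CM` is proved only modulo the 7 printed citations (2 remaining named inputs: hLiu418 =
`stmt-HodgeConjecture-24832`, h413 = `stmt-HodgeConjecture-24833`) until rung 0 closes.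

## References
* [Rogawski1990] J. D. Rogawski, *Automorphic Representations of Unitary Groups in Three Variables*, Ann. of Math. Stud. 123 (1990), §3.5 Prop. 3.5.2 (c) p. 29, §3.6 pp. 28–31,
  §4.9 Lemma 4.9.3 p. 56 (the biquadratic field `M = E·K` of an elliptic element and its third subfield).
* [Omeara1963] O. T. O'Meara, *Introduction to Quadratic Forms*, Grundlehren 117 (1963), §63B Prop. 63:13, 63:13a (non-degeneracy and bimultiplicativity of the Hilbert symbol over a
  local field, dyadic case included).
* [LabesseLanglands1979] J.-P. Labesse, R. P. Langlands, *L-indistinguishability for SL(2)*, Canad. J. Math. 31 (1979), §2 pp. 8–10.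
-/

set_option autoImplicit false

noncomputable section

open NumberField IsDedekindDomain
open Literature.NumberTheory.Automorphic Literature.NumberTheory.Automorphic.UnitaryGroup Literature.NumberTheory.QuadraticForms Literature.NumberTheory.Rogawski1990

namespace Summit.HodgeConjecture.HodgeConjecture.Cruxes.H413.F0P3cDyRamPartnerTwistScalar

/-! ## §1 A `Θ`-fixed, `ρ`-anti-fixed generator `κ` and the norm form of `K♮ = jE(F)(κ)` -/

section Algebra

variable {E M : Type} [Field E] [Field M]

/-- **A `Θ`-FIXED, `ρ`-ANTI-FIXED GENERATOR.**  In the eigen-field frame (module docstring) there are `κ ∈ M`, `β₀ ∈ E` with `Θ κ = κ`, `ρ κ = −κ`, `κ ≠ 0`, `σ β₀ = β₀`, `κ·κ = jE β₀` and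
`β₀` not a square of `E` (`κ = jE(ξ)·(λ − ρλ)`, `σ(ξ)·(−σD) = ξ`). [cite: Rogawski1990, §4.9 Lemma 4.9.3 p. 56; §3.6 pp. 28–31] -/
theorem exists_fixed_antifixed (σ : E →+* E) (hσσ : ∀ a, σ (σ a) = a) (jE : E →+* M) (ρ Θ : M →+* M)
    (hρj : ∀ a, ρ (jE a) = jE a) (hΘj : ∀ a, Θ (jE a) = jE (σ a)) (hρρ : ∀ z, ρ (ρ z) = z) (hΘρ : ∀ z, Θ (ρ z) = ρ (Θ z))
    (hjfix : ∀ z, ρ z = z ↔ ∃ a, jE a = z)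
    (h2 : (2 : E) ≠ 0) {ϑ : E} (hσϑ : σ ϑ = -ϑ) (hϑ0 : ϑ ≠ 0)
    {t D : E} (hDσ : D * σ D = 1) (hΔ : t * t - 4 * D ≠ 0)
    {lam : M} (hlam : lam * lam = jE t * lam - jE D) (hρlam : ρ lam = jE t - lam) (hΘlam : Θ lam * lam = 1) :
    ∃ (κ : M) (β₀ : E), Θ κ = κ ∧ ρ κ = -κ ∧ κ ≠ 0 ∧ σ β₀ = β₀ ∧ κ * κ = jE β₀ ∧ ¬ IsSquare β₀ := by
  have h2M : (2 : M) ≠ 0 := by rw [← map_ofNat jE 2]; exact (map_ne_zero jE).2 h2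
  have hD0 : D ≠ 0 := fun h0 => by rw [h0, zero_mul] at hDσ; exact zero_ne_one hDσ
  -- `κ₀ := λ − ρλ`: `ρκ₀ = −κ₀`, `κ₀² = jE(t² − 4D) ≠ 0`, `Θκ₀ = −jE(σD)·κ₀`
  set κ₀ : M := lam - ρ lam with hκ₀
  have hρκ₀ : ρ κ₀ = -κ₀ := by rw [hκ₀, map_sub, hρρ]; ring
  have hκ₀sq : κ₀ * κ₀ = jE (t * t - 4 * D) := by
    rw [hκ₀, hρlam, map_sub, map_mul, map_mul, map_ofNat]
    linear_combination (4 : M) * hlam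
  have hκ₀0 : κ₀ ≠ 0 := fun h0 => by
    have : jE (t * t - 4 * D) = 0 := by rw [← hκ₀sq, h0, mul_zero]
    exact hΔ ((map_eq_zero jE).1 this)
  have hlamρ : lam * ρ lam = jE D := by rw [hρlam]; linear_combination (-1 : M) * hlam
  have hlam0 : lam ≠ 0 := fun h0 => by rw [h0, mul_zero] at hΘlam; exact zero_ne_one hΘlam
  have hΘlam' : Θ lam = jE (σ D) * ρ lam := by
    apply mul_right_cancel₀ hlam0
    rw [hΘlam, mul_assoc, mul_comm (ρ lam), hlamρ, ← map_mul, mul_comm (σ D), hDσ, map_one]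
  have hΘρlam : Θ (ρ lam) = jE (σ D) * lam := by rw [hΘρ, hΘlam', map_mul, hρj, hρρ]
  have hΘκ₀ : Θ κ₀ = -(jE (σ D) * κ₀) := by rw [hκ₀, map_sub, hΘlam', hΘρlam]; ring
  -- a solution `ξ ≠ 0` of `−σ(ξ)·σD = ξ`
  obtain ⟨ξ, hξ0, hξ⟩ : ∃ ξ : E, ξ ≠ 0 ∧ -(σ ξ * σ D) = ξ := by
    by_cases h1 : σ D = 1
    · refine ⟨2 * ϑ, mul_ne_zero h2 hϑ0, ?_⟩
      rw [map_mul, map_ofNat, hσϑ, h1]; ring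
    · refine ⟨1 - σ D, sub_ne_zero.2 (Ne.symm h1), ?_⟩
      rw [map_sub, map_one, hσσ]; linear_combination hDσ
  set κ : M := jE ξ * κ₀ with hκ
  have hΘκ : Θ κ = κ := by
    rw [hκ, map_mul, hΘj, hΘκ₀, show jE (σ ξ) * -(jE (σ D) * κ₀) = jE (-(σ ξ * σ D)) * κ₀ by rw [map_neg, map_mul]; ring, hξ]
  have hρκ : ρ κ = -κ := by rw [hκ, map_mul, hρj, hρκ₀, mul_neg]
  have hκ0 : κ ≠ 0 := mul_ne_zero ((map_ne_zero jE).2 hξ0) hκ₀0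
  -- `κ² ∈ jE(E)`, `σ`-fixed, not a square
  obtain ⟨β₀, hβ₀⟩ := (hjfix (κ * κ)).1 (by rw [map_mul, hρκ]; ring)
  have hσβ₀ : σ β₀ = β₀ := jE.injective (by rw [← hΘj, hβ₀, map_mul, hΘκ])
  refine ⟨κ, β₀, hΘκ, hρκ, hκ0, hσβ₀, hβ₀.symm, ?_⟩
  rintro ⟨b, hb⟩
  have hprod : (κ - jE b) * (κ + jE b) = 0 := by
    have : κ * κ = jE b * jE b := by rw [← hβ₀, hb, map_mul]
    linear_combination this
  have hfix : ρ κ = κ := by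
    rcases mul_eq_zero.1 hprod with h | h
    · rw [sub_eq_zero.1 h, hρj]
    · rw [eq_neg_of_add_eq_zero_left h, map_neg, hρj]
  rw [hρκ] at hfix
  exact hκ0 (mul_left_cancel₀ h2M (by linear_combination -hfix))

/-- The norm form of `K♮ = jE(F) ⊕ jE(F)·κ`: `(x + yκ)·ρ(x + yκ) = x² − β₀ y²`. [cite: Rogawski1990, §3.6 pp. 28–31] -/
theorem twist_norm (jE : E →+* M) (ρ : M →+* M) (hρj : ∀ a, ρ (jE a) = jE a) {κ : M} (hρκ : ρ κ = -κ) {β₀ : E} (hκ : κ * κ = jE β₀) (x y : E) :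
    (jE x + jE y * κ) * ρ (jE x + jE y * κ) = jE (x * x - β₀ * y * y) := by
  rw [map_add, map_mul, hρj, hρj, hρκ, map_sub, map_mul, map_mul, map_mul, ← hκ]; ring

/-- `x + yκ` is `Θ`-fixed when `x, y` are `σ`-fixed. [cite: Rogawski1990, §3.6 pp. 28–31] -/
theorem twist_fixed (σ : E →+* E) (jE : E →+* M) (Θ : M →+* M) (hΘj : ∀ a, Θ (jE a) = jE (σ a)) {κ : M} (hΘκ : Θ κ = κ)
    {x y : E} (hx : σ x = x) (hy : σ y = y) : Θ (jE x + jE y * κ) = jE x + jE y * κ := by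
  rw [map_add, map_mul, hΘj, hΘj, hΘκ, hx, hy]

end Algebra

/-! ## §2 The twist scalar at a CM place -/

section CM

variable (L : Type) [Field L] [NumberField L] [IsCMField L] {v : HeightOneSpectrum (𝓞 ↥(maximalRealSubfield L))}
  (w : PlacesOver L v) (hw : IsCMField.complexConj L • w.1 = w.1)

include hw in
/-- **O-Lit brick 2 (β): THE TWIST SCALAR.**  At a place `w ∣ v` of the CM field `L` fixed by complex conjugation (any residue characteristic), in the eigen-field frame over `E = L_w`,
`σ = σ_w` (module docstring): there are `n₀ ∈ M` and `a₀ ∈ L⁺_v` with `Θ n₀ = n₀`, `n₀ ≠ 0`, `a₀ ≠ 0`, `n₀·ρ(n₀) = jE(ι_w a₀)` and `(a₀, θ)_v = −1` — the norm `N_{M∕E}(n₀)` is NOT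
a norm from `L_w`. [cite: Rogawski1990, §3.5 Prop. 3.5.2 (c) p. 29; §4.9 Lemma 4.9.3 p. 56] [cite: Omeara1963, §63B Prop. 63:13, 63:13a] [cite: LabesseLanglands1979, §2 pp. 8–10] -/
theorem exists_twistScalar {M : Type} [Field M] (jE : w.1.adicCompletion L →+* M) (ρ Θ : M →+* M)
    (hρj : ∀ a, ρ (jE a) = jE a) (hΘj : ∀ a, Θ (jE a) = jE (galAdicCompletionMap (L := L) (IsCMField.complexConj L) hw a))
    (hρρ : ∀ z, ρ (ρ z) = z) (hΘρ : ∀ z, Θ (ρ z) = ρ (Θ z)) (hjfix : ∀ z, ρ z = z ↔ ∃ a, jE a = z)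
    {t D : w.1.adicCompletion L} (hDσ : D * galAdicCompletionMap (L := L) (IsCMField.complexConj L) hw D = 1) (hΔ : t * t - 4 * D ≠ 0)
    {lam : M} (hlam : lam * lam = jE t * lam - jE D) (hρlam : ρ lam = jE t - lam) (hΘlam : Θ lam * lam = 1) :
    ∃ (n₀ : M) (a₀ : v.adicCompletion ↥(maximalRealSubfield L)), Θ n₀ = n₀ ∧ n₀ ≠ 0 ∧ a₀ ≠ 0 ∧ n₀ * ρ n₀ = jE (toPlace v w a₀) ∧
      hilbertSymbol (v.adicCompletion ↥(maximalRealSubfield L)) a₀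
        (algebraMap ↥(maximalRealSubfield L) _ ((cmQuadraticGenerator L : 𝓞 ↥(maximalRealSubfield L)) : ↥(maximalRealSubfield L))) = -1 := by
  classical
  set F := v.adicCompletion ↥(maximalRealSubfield L) with hFdef
  set σ := galAdicCompletionMap (L := L) (IsCMField.complexConj L) hw with hσdef
  set θ : F := algebraMap ↥(maximalRealSubfield L) _ ((cmQuadraticGenerator L : 𝓞 ↥(maximalRealSubfield L)) : ↥(maximalRealSubfield L)) with hθdef
  have hc1 : IsCMField.complexConj L ≠ 1 := IsCMField.complexConj_ne_one L
  haveI : CharZero (w.1.adicCompletion L) := charZero_of_injective_algebraMap (algebraMap L (w.1.adicCompletion L)).injective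
  haveI : CharZero F := charZero_of_injective_algebraMap (algebraMap ↥(maximalRealSubfield L) F).injective
  haveI : NeZero (2 : F) := ⟨two_ne_zero⟩
  have hσσ : ∀ x, σ (σ x) = x := fun x => galAdicCompletionMap_galAdicCompletionMap_of_smul_eq (IsCMField.complexConj L) w hc1 hw x
  -- the CM square root `ϑ` of `θ` in `L_w`
  obtain ⟨α, hα0, hcα, hαsq⟩ := cmQuadraticGenerator_spec L
  set ϑ : w.1.adicCompletion L := ((α : L) : w.1.adicCompletion L) with hϑdef
  have hσϑ : σ ϑ = -ϑ := by
    rw [hϑdef, hσdef, galAdicCompletionMap_coe (L := L) (IsCMField.complexConj L) hw α, AlgEquiv.smul_def, hcα]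
    exact map_neg (algebraMap L (w.1.adicCompletion L)) α
  have hϑ0 : ϑ ≠ 0 := by rw [hϑdef]; exact (map_ne_zero (algebraMap L (w.1.adicCompletion L))).2 hα0
  have hϑsq : ϑ * ϑ = toPlace v w θ := by
    have h := Literature.NumberTheory.NumberFields.algebraMap_adicCompletion_sq_eq_toPlace L v w hαsq.symm
    rw [sq] at h
    exact h
  -- §1: `κ`, `β₀`
  obtain ⟨κ, β₀, hΘκ, hρκ, hκ0, hσβ₀, hκsq, hβns⟩ :=
    exists_fixed_antifixed σ hσσ jE ρ Θ hρj hΘj hρρ hΘρ hjfix two_ne_zero hσϑ hϑ0 hDσ hΔ hlam hρlam hΘlam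
  -- `β₀ = ι_w β` with `β ∈ L⁺_v`; `θβ` is a non-square of `L⁺_v`
  obtain ⟨β, hβ⟩ := exists_toPlace_eq_of_galAdicCompletionMap_eq (IsCMField.complexConj L) w hc1 hw β₀ hσβ₀
  have hβ0 : β ≠ 0 := by
    intro h0; rw [h0, map_zero] at hβ
    exact hκ0 (by have := hκsq; rw [← hβ, map_zero, mul_self_eq_zero] at this; exact this)
  have hθ0 : θ ≠ 0 := by
    intro h0
    have : ϑ * ϑ = 0 := by rw [hϑsq, h0, map_zero]
    exact hϑ0 (mul_self_eq_zero.1 this)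
  have hθβ0 : θ * β ≠ 0 := mul_ne_zero hθ0 hβ0
  have hθβns : ¬ IsSquare (θ * β) := by
    rintro ⟨r, hr⟩
    apply hβns
    -- `ι_w(θβ) = ϑ²·β₀ = ι_w(r)²` so `β₀ = (ι_w r ∕ ϑ)²`
    refine ⟨toPlace v w r / ϑ, ?_⟩
    have h1 : ϑ * ϑ * β₀ = toPlace v w r * toPlace v w r := by rw [hϑsq, ← hβ, ← map_mul, ← map_mul, hr]
    field_simp
    linear_combination h1
  -- non-degeneracy on `θβ`, and a non-norm `ε`
  obtain ⟨a, ha0, ha⟩ := adicCompletion_exists_hilbertSymbol_eq_neg_one_holds ↥(maximalRealSubfield L) v (θ * β) hθβ0 hθβns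
  have hsplit : hilbertSymbol F a θ * hilbertSymbol F a β = -1 := by
    rw [← hilbertSymbol_adicCompletion_mul_right ↥(maximalRealSubfield L) v hθ0 hβ0 ha0]; exact ha
  obtain ⟨ε₀, hσε₀, hε₀0, hε₀N, -⟩ := Literature.NumberTheory.LocalFields.IsCMField.exists_fixed_nonnorm_dichotomy' L w hw
  obtain ⟨ε, hε⟩ := exists_toPlace_eq_of_galAdicCompletionMap_eq (IsCMField.complexConj L) w hc1 hw ε₀ hσε₀
  have hε0 : ε ≠ 0 := by
    rintro rfl
    exact hε₀0 (hε.symm.trans (map_zero _))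
  have hεθ : hilbertSymbol F ε θ = -1 := by
    refine (hilbertSymbol_eq_neg_one_iff_not_exists_norm_toPlace L v w hw hε0).2 ?_
    rintro ⟨z, hz⟩
    refine hε₀N ⟨z, ?_⟩
    rw [mul_comm]
    exact hz.trans hε
  -- some `a₀ ≠ 0` with `(a₀, θ) = −1`, `(a₀, β) = 1`
  obtain ⟨a₀, ha₀0, ha₀θ, ha₀β⟩ : ∃ a₀ : F, a₀ ≠ 0 ∧ hilbertSymbol F a₀ θ = -1 ∧ hilbertSymbol F a₀ β = 1 := by
    rcases hilbertSymbol_eq_one_or_eq_neg_one a θ with haθ | haθ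
    · -- `(a, θ) = 1`, so `(a, β) = −1`; use `ε` or `ε·a`
      have haβ : hilbertSymbol F a β = -1 := by rw [haθ, one_mul] at hsplit; exact hsplit
      rcases hilbertSymbol_eq_one_or_eq_neg_one ε β with hεβ | hεβ
      · exact ⟨ε, hε0, hεθ, hεβ⟩
      · refine ⟨ε * a, mul_ne_zero hε0 ha0, ?_, ?_⟩
        · rw [hilbertSymbol_adicCompletion_mul_left ↥(maximalRealSubfield L) v hε0 ha0 hθ0, hεθ, haθ]; norm_num
        · rw [hilbertSymbol_adicCompletion_mul_left ↥(maximalRealSubfield L) v hε0 ha0 hβ0, hεβ, haβ]; norm_num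
    · have haβ : hilbertSymbol F a β = 1 := by
        rw [haθ] at hsplit
        rcases hilbertSymbol_eq_one_or_eq_neg_one a β with h | h
        · exact h
        · rw [h] at hsplit; norm_num at hsplit
      exact ⟨a, ha0, haθ, haβ⟩
  -- `a₀ = x² − β y²`
  obtain ⟨x, y, hxy⟩ := (hilbertSymbol_eq_one_iff_exists_norm hβ0 ha₀0).1 (by rw [hilbertSymbol_comm]; exact ha₀β)
  refine ⟨jE (toPlace v w x) + jE (toPlace v w y) * κ, a₀, ?_, ?_, ha₀0, ?_, ha₀θ⟩
  · exact twist_fixed σ jE Θ hΘj hΘκ (galAdicCompletionMap_toPlace (IsCMField.complexConj L) w w hw x) (galAdicCompletionMap_toPlace (IsCMField.complexConj L) w w hw y)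
  · intro h0
    have hn : (jE (toPlace v w x) + jE (toPlace v w y) * κ) * ρ (jE (toPlace v w x) + jE (toPlace v w y) * κ) = jE (toPlace v w a₀) := by
      rw [twist_norm jE ρ hρj hρκ hκsq, ← hβ, ← map_mul, ← map_mul, ← map_mul, ← map_sub, ← hxy]; ring_nf
    rw [h0, zero_mul, eq_comm, map_eq_zero_iff jE jE.injective, map_eq_zero_iff _ (toPlace v w).injective] at hn
    exact ha₀0 hn
  · rw [twist_norm jE ρ hρj hρκ hκsq, ← hβ, ← map_mul, ← map_mul, ← map_mul, ← map_sub, ← hxy]; ring_nf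

end CM


end Summit.HodgeConjecture.HodgeConjecture.Cruxes.H413.F0P3cDyRamPartnerTwistScalar

end
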